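import Literature.Analysis.FluidPDE.ReleaseLogBoundSmooth
import Summits.AnomalousDissipation.AnomalousDissipation.Theorems.SawtoothPulseCascadeK1LocalisedCascadeHighModeGlue
import Summits.AnomalousDissipation.AnomalousDissipation.Theorems.SawtoothPulseCascadeK1LocalisedCascadeSlotRestart

/-!
# K1loc, line `Spectral` / SeqCone — helper: THE FINISH LINE OF THE BOOKKEEPING IN THE STUB'S VOCABULARY (S-C endgame)

Helper file of the prover lane on the crux `K1LocalisedCascade` (stmt-AnomalousDissipation-19491), route
`SawtoothPulseCascade` (memo v6 §4, S-C).  The half-slot chain (`…FamilyStep`, `…FamilySplit`, `…SlotRestart`) delivers, at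
the final time `T = tStart J`, a decomposition `w(T) = d + z` (tracked good piece `d`, accumulated junk `z`) with a bound on
the tracked energy `Σ μ²|𝓕d|²` for a symbol `μ² ≥ 1` on the low block `|k_i| < K`, and a bound on `‖z‖`.  This file converts
such data into the registered stub's conclusion:
* `sqrt_lowModeEnergy_le_of_split` — `√E_low(w(T)) ≤ √(Σ μ²|𝓕d|²) + ‖z‖_{L²}` (low block dominated by the tracked symbol;
  weighted Minkowski `…SlotRestart.sqrt_tsum_symbol_sq_add_le`);
* `energyIdentityE_of_Ico` — the energy identity in extended form for classical solutions on `[0,1)`;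
* `stub_form_of_lowModeEnergy_le` — if `E_low(w(T)) ≤ (1 − 2χ)‖w(0)‖²` then
  `ofReal(2χ‖w(0)‖²) ≤ highModeEnergy i K (w T) + 2·eScalarDissipation κ w 0 T` (Parseval split via
  `…HighModeGlue.scalarL2Sq_sub_tsum_symbol_sq_le_highModeEnergy` + the energy identity), for ANY smooth divergence-free drift —
  with `i = 0`, `T = tStart (Jrate (γ²−3) κ + A)`, `w 0 = datum` this is literally the inequality of `stub_highModeConcentration`.
No definitions; no statement about the stub itself.
[cite: Grafakos2014, Prop. 3.2.7 (3) (Parseval)] [cite: DEIJ2022, (1.2)–(1.3) (dissipated fraction of the variance)] [problem: turb]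
-/

-- `Summit.<Summit>.<Problem>`: single-conjunct summit, the duplicate namespace segment is deliberate.
set_option linter.dupNamespace false

noncomputable section

namespace Summit.AnomalousDissipation.AnomalousDissipation.Theorems.SawtoothPulseCascade.K1Slot

open MeasureTheory Set Filter Topology UnitAddTorus Function
open scoped ENNReal
open Literature.Analysis Literature.Analysis.FunctionSpaces Literature.Analysis.FunctionSpaces.Torus
open Literature.Analysis.FluidPDE.Torus (highModeEnergy)
open Summit.AnomalousDissipation.AnomalousDissipation.Theorems.SawtoothPulseCascade.SpectralLeakage

variable {d : Type*} [Fintype d] [DecidableEq d]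

/-! ## The low block of a split `w = d + z` -/

omit [DecidableEq d] in
/-- **Low-block energy of a split.**  For continuous real `f, z` and a bounded real symbol `μ` with `μ² ≥ 1` on the low block
`|k_i| < K`: `√(Σ_{|k_i|<K} |𝓕(f+z)|²) ≤ √(Σ μ²|𝓕f|²) + ‖z‖_{L²}` (the tracked symbol dominates the low block of the good
piece; the junk enters with its full norm). [cite: Grafakos2014, Prop. 3.2.7 (3)] -/
theorem sqrt_lowModeEnergy_le_of_split {f z : UnitAddTorus d → ℝ} (hf : Continuous f) (hz : Continuous z) (i : d) (K : ℝ)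
    {μ : (d → ℤ) → ℝ} {M : ℝ} (hμM : ∀ k, |μ k| ≤ M) (hlow : ∀ k : d → ℤ, |((k i : ℤ) : ℝ)| < K → 1 ≤ μ k ^ 2) :
    Real.sqrt (∑' k, (if |((k i : ℤ) : ℝ)| < K then (1 : ℝ) else 0) *
        ‖mFourierCoeff (fun x => ((f x + z x : ℝ) : ℂ)) k‖ ^ 2) ≤
      Real.sqrt (∑' k, μ k ^ 2 * ‖mFourierCoeff (fun x => (f x : ℂ)) k‖ ^ 2) + Real.sqrt (∫ x, z x ^ 2) := by
  classical
  have hfc : Continuous fun x => (f x : ℂ) := Complex.continuous_ofReal.comp hf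
  have hzc : Continuous fun x => (z x : ℂ) := Complex.continuous_ofReal.comp hz
  have hw0 : ∀ k : d → ℤ, 0 ≤ (if |((k i : ℤ) : ℝ)| < K then (1 : ℝ) else 0) := fun k => by split_ifs <;> norm_num
  have hw1 : ∀ k : d → ℤ, (if |((k i : ℤ) : ℝ)| < K then (1 : ℝ) else 0) ≤ 1 := fun k => by split_ifs <;> norm_num
  have hsplit := sqrt_tsum_symbol_sq_add_le hfc hzc hw0 hw1
  have hfun : (fun x => ((f x + z x : ℝ) : ℂ)) = fun x => (f x : ℂ) + (z x : ℂ) := by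
    funext x; push_cast; ring
  rw [hfun]
  have hz2 : ∫ x, ‖(z x : ℂ)‖ ^ 2 = ∫ x, z x ^ 2 := by
    refine integral_congr_ae (ae_of_all _ fun x => ?_)
    simp only [Complex.norm_real, Real.norm_eq_abs, sq_abs]
  rw [hz2] at hsplit
  -- domination of the low block by the tracked symbol
  have hdom : ∑' k, (if |((k i : ℤ) : ℝ)| < K then (1 : ℝ) else 0) * ‖mFourierCoeff (fun x => (f x : ℂ)) k‖ ^ 2 ≤
      ∑' k, μ k ^ 2 * ‖mFourierCoeff (fun x => (f x : ℂ)) k‖ ^ 2 := by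
    have hM0 : 0 ≤ M := (abs_nonneg _).trans (hμM 0)
    have hμ2 : ∀ k, μ k ^ 2 ≤ M ^ 2 := fun k => by
      rw [← sq_abs]; exact pow_le_pow_left₀ (abs_nonneg _) (hμM k) 2
    have hP := hasSum_sq_mFourierCoeff_of_continuous hfc
    have hsμ : Summable fun k => μ k ^ 2 * ‖mFourierCoeff (fun x => (f x : ℂ)) k‖ ^ 2 :=
      (hP.summable.mul_left (M ^ 2)).of_nonneg_of_le (fun k => by positivity)
        fun k => mul_le_mul_of_nonneg_right (hμ2 k) (sq_nonneg _)
    have hle : ∀ k, (if |((k i : ℤ) : ℝ)| < K then (1 : ℝ) else 0) * ‖mFourierCoeff (fun x => (f x : ℂ)) k‖ ^ 2 ≤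
        μ k ^ 2 * ‖mFourierCoeff (fun x => (f x : ℂ)) k‖ ^ 2 := fun k => by
      refine mul_le_mul_of_nonneg_right ?_ (sq_nonneg _)
      split_ifs with h
      · exact hlow k h
      · exact sq_nonneg _
    exact (hsμ.of_nonneg_of_le (fun k => mul_nonneg (hw0 k) (sq_nonneg _)) hle).tsum_le_tsum hle hsμ
  exact hsplit.trans (add_le_add (Real.sqrt_le_sqrt hdom) le_rfl)

/-! ## The energy identity in extended form -/

/-- **The energy identity of a classical scalar on `[0,1)` in extended form**: for `0 ≤ t < 1`,
`ofReal ‖w(t)‖² + 2·eScalarDissipation κ w 0 t = ofReal ‖w(0)‖²` (the registered composition's `energyIdentityE`, for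
any smooth divergence-free drift). [cite: DEIJ2022, (1.2)–(1.3)] -/
theorem energyIdentityE_of_Ico {κ : ℝ} (hκ : 0 ≤ κ) {u : ℝ → UnitAddTorus d → EuclideanSpace ℝ d}
    {w : ℝ → UnitAddTorus d → ℝ} (hw : FluidPDE.Torus.IsClassicalScalarTransportOn (Ico 0 1) κ u w)
    {t : ℝ} (ht0 : 0 ≤ t) (ht1 : t < 1) :
    ENNReal.ofReal (FluidPDE.Torus.scalarL2Sq (w t)) + 2 * FluidPDE.Torus.eScalarDissipation κ w 0 t =
      ENNReal.ofReal (FluidPDE.Torus.scalarL2Sq (w 0)) := by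
  rcases ht0.eq_or_lt with h0 | ht0'
  · subst h0
    simp [FluidPDE.Torus.eScalarDissipation]
  have hS : Icc 0 t ⊆ Ico (0 : ℝ) 1 := fun s hs => ⟨hs.1, hs.2.trans_lt ht1⟩
  have hw' := hw.restrict_Icc ht0' hS
  have hid := FluidPDE.Torus.IsClassicalScalarTransportOn.scalarL2Sq_add_scalarDissipation_holds hw ht0'.le hS
  have hD : 0 ≤ FluidPDE.Torus.scalarDissipation κ w 0 t := FluidPDE.Torus.scalarDissipation_nonneg hκ w ht0'.le
  rw [FluidPDE.Torus.eScalarDissipation_eq_ofReal hκ ht0' hw']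
  have h2 : (2 : ℝ≥0∞) * ENNReal.ofReal (FluidPDE.Torus.scalarDissipation κ w 0 t) =
      ENNReal.ofReal (2 * FluidPDE.Torus.scalarDissipation κ w 0 t) := by
    rw [ENNReal.ofReal_mul (by norm_num : (0 : ℝ) ≤ 2), ENNReal.ofReal_ofNat]
  rw [h2, ← ENNReal.ofReal_add (FluidPDE.Torus.scalarL2Sq_nonneg _) (by positivity), hid]

/-! ## From a low-block bound to the stub's inequality -/

/-- **The finish line.**  For a classical scalar `w` on `[0,1)` (any smooth divergence-free drift, `κ ≥ 0`), a time
`0 ≤ T < 1`, a direction `i`, a threshold `K` and a fraction `χ`: if the low-block energy of `w(T)` is at most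
`(1 − 2χ)‖w(0)‖²`, i.e. `Σ_{|k_i|<K} |𝓕(w T)(k)|² ≤ (1 − 2χ)·scalarL2Sq (w 0)`, then
`ofReal(2χ·scalarL2Sq (w 0)) ≤ highModeEnergy i K (w T) + 2·eScalarDissipation κ w 0 T` — the conclusion of
`stub_highModeConcentration` at `(K, T)`. [cite: Grafakos2014, Prop. 3.2.7 (3)] [cite: DEIJ2022, (1.2)–(1.3)] -/
theorem stub_form_of_lowModeEnergy_le {κ : ℝ} (hκ : 0 ≤ κ) {u : ℝ → UnitAddTorus d → EuclideanSpace ℝ d}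
    {w : ℝ → UnitAddTorus d → ℝ} (hw : FluidPDE.Torus.IsClassicalScalarTransportOn (Ico 0 1) κ u w)
    {T : ℝ} (hT0 : 0 ≤ T) (hT1 : T < 1) (i : d) (K : ℝ) {χ : ℝ}
    (hle : ∑' k, (if |((k i : ℤ) : ℝ)| < K then (1 : ℝ) else 0) * ‖mFourierCoeff (fun x => (w T x : ℂ)) k‖ ^ 2 ≤
      (1 - 2 * χ) * FluidPDE.Torus.scalarL2Sq (w 0)) :
    ENNReal.ofReal (2 * χ * FluidPDE.Torus.scalarL2Sq (w 0)) ≤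
      highModeEnergy i K (w T) + 2 * FluidPDE.Torus.eScalarDissipation κ w 0 T := by
  classical
  have hTmem : T ∈ Ico (0 : ℝ) 1 := ⟨hT0, hT1⟩
  have hwT : Continuous (w T) := (hw.smooth_scalar.isSmooth_slice hTmem).continuous
  -- the low block via the indicator symbol
  set m : (d → ℤ) → ℝ := fun k => if |((k i : ℤ) : ℝ)| < K then 1 else 0 with hm
  have hmM : ∀ k, |m k| ≤ 1 := fun k => by simp only [hm]; split_ifs <;> norm_num
  have hmlow : ∀ k : d → ℤ, |((k i : ℤ) : ℝ)| < K → 1 ≤ m k ^ 2 := fun k hk => by simp [hm, hk]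
  have hm2 : ∀ k, m k ^ 2 = m k := fun k => by simp only [hm]; split_ifs <;> norm_num
  have hH := scalarL2Sq_sub_tsum_symbol_sq_le_highModeEnergy hwT i K hmM hmlow
  set a := FluidPDE.Torus.scalarL2Sq (w T) with ha
  set b := FluidPDE.Torus.scalarL2Sq (w 0) with hb
  set e := ∑' k, m k ^ 2 * ‖mFourierCoeff (fun x => (w T x : ℂ)) k‖ ^ 2 with he
  have he' : e = ∑' k, (if |((k i : ℤ) : ℝ)| < K then (1 : ℝ) else 0) * ‖mFourierCoeff (fun x => (w T x : ℂ)) k‖ ^ 2 :=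
    tsum_congr fun k => by rw [hm2]
  have hele : e ≤ (1 - 2 * χ) * b := by rw [he']; exact hle
  -- `e ≤ a` (Parseval) and `a ≤ b` (energy identity in ℝ)
  have hP := hasSum_sq_norm_mFourierCoeff_scalarL2Sq hwT
  have hea : e ≤ a := by
    rw [he, ha, ← hP.tsum_eq]
    refine Summable.tsum_le_tsum (fun k => ?_) ?_ hP.summable
    · calc m k ^ 2 * ‖mFourierCoeff (fun x => (w T x : ℂ)) k‖ ^ 2 ≤ 1 * ‖mFourierCoeff (fun x => (w T x : ℂ)) k‖ ^ 2 :=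
          mul_le_mul_of_nonneg_right (by rw [hm2]; exact (le_abs_self _).trans (hmM k)) (sq_nonneg _)
        _ = _ := one_mul _
    · exact (hP.summable.mul_left 1).of_nonneg_of_le (fun k => by positivity)
        fun k => mul_le_mul_of_nonneg_right (by rw [hm2]; exact (le_abs_self _).trans (hmM k)) (sq_nonneg _)
  have hab : a ≤ b ∧ ENNReal.ofReal (b - a) ≤ 2 * FluidPDE.Torus.eScalarDissipation κ w 0 T := by
    rcases hT0.eq_or_lt with h0 | hT0'
    · have hab' : a = b := by rw [ha, hb, h0]
      refine ⟨hab'.le, ?_⟩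
      rw [hab', sub_self, ENNReal.ofReal_zero]; exact bot_le
    · have hS : Icc 0 T ⊆ Ico (0 : ℝ) 1 := fun s hs => ⟨hs.1, hs.2.trans_lt hT1⟩
      have hid := FluidPDE.Torus.IsClassicalScalarTransportOn.scalarL2Sq_add_scalarDissipation_holds hw hT0'.le hS
      have hD : 0 ≤ FluidPDE.Torus.scalarDissipation κ w 0 T := FluidPDE.Torus.scalarDissipation_nonneg hκ w hT0'.le
      have hw' := hw.restrict_Icc hT0' hS
      refine ⟨by rw [ha, hb]; linarith, le_of_eq ?_⟩
      rw [FluidPDE.Torus.eScalarDissipation_eq_ofReal hκ hT0' hw', ← ENNReal.ofReal_ofNat,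
        ← ENNReal.ofReal_mul (by norm_num : (0 : ℝ) ≤ 2)]
      congr 1
      rw [ha, hb]; linarith
  obtain ⟨hab1, hab2⟩ := hab
  -- assemble in `ℝ≥0∞`
  calc ENNReal.ofReal (2 * χ * b) ≤ ENNReal.ofReal ((a - e) + (b - a)) := ENNReal.ofReal_le_ofReal (by linarith)
    _ = ENNReal.ofReal (a - e) + ENNReal.ofReal (b - a) := ENNReal.ofReal_add (by linarith) (by linarith)
    _ ≤ highModeEnergy i K (w T) + 2 * FluidPDE.Torus.eScalarDissipation κ w 0 T := add_le_add hH hab2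

end Summit.AnomalousDissipation.AnomalousDissipation.Theorems.SawtoothPulseCascade.K1Slot
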